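import Summits.QuantumFields.YangMills.Theorems.AlphaInputsT3ACv3AbelianTensorSums
import Summits.QuantumFields.YangMills.Theorems.AlphaInputsT3ACv3LinearLiftGauge
import HarnessLib

/-!
# `AlphaInputsT3ACv3OneBlockLiftDefs` — (r1-ob) THE ONE-BLOCK EXACT ELEMENTARY LIFT OF THE `k`-FOLD LINEAR (0.4) AVERAGE: DEFINITIONS — lane `pub-balaban3d` ∕ cell `ym3-torus`,
# seat alpha-2 (g6); KERNEL OF RECORD for the regional Newton route (★★OWNER ym3-torus-plan g25 03:01:17Z, LEAD ★w1-19936 g2 casting vote 03:02:18Z)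

WHY (HOME `pub-balaban3d/ONE-BLOCK-KERNEL-alpha2-g6.md`).  The Newton construction of the exact non-abelian `k`-fold lift (`hLift`, the (FL) row of R3 2′∕2′χ) needs a right inverse
`R` of the linearised `k`-fold average `Q^{(k)} = linAvgIter k`: an EXACT lift `A ↦ R A`, `linAvgIter k (R A) = A`, with sup `O(‖A‖/L^k)` and curl `O(‖A‖/L^{2k})`.  The engine of
record `LinearLiftSpread.liftS` spreads over `7^d` cells, so its twisted version must compare frames across block faces ((r1-σ) gluing, (r1-cone) cut faces at double-cone
vertices, (r1-route)).  THIS FILE defines a right inverse whose elementary kernel `e_c` (the lift of the coarse one-form `δ_c`, `c = (y, α)`) lives on the finest bonds with SOURCE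
IN THE ONE BLOCK `B^k(y)`: the product of the hosted 1D profile `h` of `…v3AbelianShapes1D` along `α` (`Σ h = 1`, cumulative with zero block sum) with mean-one TENTS across
(vanishing on the block's transverse boundary layers, so the curl has no face term), plus the pure gauge `Ψ_k(e⁰_c)(y)·d χ_y` of a bump `χ_y` peaked at the block centre, which
cancels the (0.4) coboundary `d(Ψ_k e⁰_c)` (one-block locality of `Ψ_k`: it is `Ψ_k(e⁰_c)(y)·δ_y`).  Exactness, support, sup and curl bounds are proved in the sibling files
`…v3OneBlockLift` ∕ `…v3OneBlockLiftBounds`; the matrix ∕ twisted port is ★w3-19936's `…v3OneBlockLiftMatrix`.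
WHAT (the `K`-th approximation of a `T3Family`, coarse level `k`, `n = L^k`, period `N₀`; all shapes are the periodic home-block-hosted functions of the cyclic offsets
`ρ_i(y, z)` of `…v3AbelianTensor`): §1 the 1D shapes — `tentW`∕`tentZ`∕`tentV` (the tent `min(r, n−1−r)` normalised to mean one), `tS` (its hosted periodic form), `bumpV`∕`bumpS`
(the bump `max(0, 1 − |r − c|/((n−1)/2))` about an offset `c`); §2 `ctr` (the offsets of the block centre `toFine k y`), ★ `e0` (the product form on the `α`-bonds of `B^k(y)`),
`chiB` (the centre bump), ★ `obKernel y α := e0 y α + Ψ_k(e0 y α)(y)·dgrad (chiB y)`, ★★ `obLift A := Σ_c A(c)·obKernel c₋ (dir c)` and its linear-map packaging `obLiftL`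
(`obLift_add`, `obLift_smul` for ★w3's `byEntry` port).
HONEST FRAMING.  Definitions only (plus two linearity letters); count-neutral helper toward the (FL)∕KIN row `hLift` of R3 2′∕2′χ (`stub_laneRecordsV3`, items 19935∕19936 —
NOT proved here); registry untouched; nothing about d = 4, the continuum limit, or a mass gap; YM₃ on T³ is rung R3 of the programme, not the Clay problem.

References: T. Bałaban, Commun. Math. Phys. 109 (1987) 249–301 [Balaban1987RG1] ((0.3) p.252, (0.4)+(0.11) p.253); Commun. Math. Phys. 102 (1985) 277–309
[Balaban1985Variational] ((8) p.279, the regular exact lift); Commun. Math. Phys. 98 (1985) 17–51 [Balaban1985Averaging] ((14) p.19).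
-/

set_option autoImplicit false

noncomputable section

namespace Summit.QuantumFields.YangMills.Theorems.AbelianEML.OneBlock

open scoped BigOperators
open Literature.MathematicalPhysics.QuantumFieldTheory.Balaban1983to89
open Literature.MathematicalPhysics.QuantumFieldTheory.Balaban1983to89.T3ContinuumYM3Torus
open Literature.MathematicalPhysics.QuantumFieldTheory.Balaban1983to89.B10Eq38TorusDomains (toFine)
open Summit.QuantumFields.YangMills.Theorems.AbelianEML.Shapes1D
open Summit.QuantumFields.YangMills.Theorems.AbelianEML.Tensor (rho form3 N0 nc)
open Summit.QuantumFields.YangMills.Theorems.LinearLiftGauge (dgrad psiIter)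

/-! ## §1 The 1D shapes: the mean-one tent and the centre bump -/

/-- The tent weights `min(r, n−1−r)` on the offsets `0 … n−1` of a block (zero on the two boundary offsets). [cite: Balaban1985Variational, (8) p.279] -/
def tentW (n r : ℕ) : ℝ := ((min r (n - 1 - r) : ℕ) : ℝ)

/-- The total tent weight `Σ_{r<n} min(r, n−1−r)` (positive once `n ≥ 3`). [cite: Balaban1985Variational, (8) p.279] -/
def tentZ (n : ℕ) : ℝ := ∑ r ∈ Finset.range n, tentW n r

/-- **THE MEAN-ONE TENT** `n·min(r, n−1−r) / Σ min`: sums to `n` over the block, vanishes on the boundary offsets `0` and `n−1`. [cite: Balaban1985Variational, (8) p.279] -/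
def tentV (n r : ℕ) : ℝ := (n : ℝ) * tentW n r / tentZ n

/-- The tent HOSTED IN THE HOME BLOCK, as a periodic function of the cyclic offset (pattern of `Shapes1D.hS false`). [cite: Balaban1987RG1, (0.3) p.252] -/
def tS (n N : ℕ) : ℕ → ℝ := per N fun r => if r < n then tentV n r else 0

/-- The bump `max(0, 1 − |r − c| / ((n−1)/2))` about the offset `c` (for `c = (n−1)/2`, `n` odd: `1` at the centre, `0` on the boundary offsets). [cite: Balaban1987RG1, (0.3) p.252] -/
def bumpV (n c r : ℕ) : ℝ := max 0 (1 - |(r : ℝ) - (c : ℝ)| / (((n : ℝ) - 1) / 2))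

/-- The bump hosted in the home block, as a periodic function of the cyclic offset. [cite: Balaban1987RG1, (0.3) p.252] -/
def bumpS (n N c : ℕ) : ℕ → ℝ := per N fun r => if r < n then bumpV n c r else 0

/-! ## §2 The elementary kernel and the lift -/

section Defs

variable (F : T3Family) (K k : ℕ)

/-- The cyclic offsets of the CENTRE `toFine k y` of the block `B^k(y)`, reduced mod `N₀`. [cite: Balaban1987RG1, (0.3) p.252] -/
def ctr (y : Site (F.P K) k) (i : Fin 3) : ℕ := rho y (toFine k y) i % N0 F K

/-- **★ THE PRODUCT FORM `e⁰_{(y,α)}`**: on the `α`-bonds with source in `B^k(y)` the value `h(ρ_α)·Π_{i ≠ α} tent(ρ_i)` (hosted profile along `α`, mean-one tents across), zero on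
every other bond. Its tube averages are `δ_{(y,α)}` and its curl is `O(1/L^{2k})`. [cite: Balaban1985Variational, (8) p.279] -/
def e0 (y : Site (F.P K) k) (α : Fin 3) : PBond (F.P K) 0 → ℝ :=
  form3 fun μ z => if μ = α then hS false (F.L ^ k) (N0 F K) (rho y z α) * ∏ i ∈ Finset.univ.erase α, tS (F.L ^ k) (N0 F K) (rho y z i) else 0

/-- **THE CENTRE BUMP `χ_y`** of the block `B^k(y)`: the product of the three coordinate bumps about the centre's offsets (`1` at `toFine k y`, supported in `B^k(y)`).
[cite: Balaban1987RG1, (0.3) p.252] -/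
def chiB (y : Site (F.P K) k) (z : Site (F.P K) 0) : ℝ :=
  ∏ i : Fin 3, bumpS (F.L ^ k) (N0 F K) (ctr F K k y i) (rho y z i)

/-- **★ THE ONE-BLOCK ELEMENTARY KERNEL** `e_{(y,α)} := e⁰_{(y,α)} + Ψ_k(e⁰_{(y,α)})(y)·dχ_y` — the pure gauge cancels the (0.4) coboundary of the product form, so that
`linAvgIter k e_{(y,α)} = δ_{(y,α)}` exactly (`…v3OneBlockLift`). [cite: Balaban1987RG1, (0.4)+(0.11) p.253] -/
def obKernel (y : Site (F.P K) k) (α : Fin 3) : PBond (F.P K) 0 → ℝ :=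
  fun b => e0 F K k y α b + psiIter k (e0 F K k y α) y * dgrad (chiB F K k y) b

/-- **★★ THE ONE-BLOCK LIFT** `obLift A := Σ_c A(c)·e_c` — a right inverse of `linAvgIter k` whose kernel for the coarse bond `c` lives in the block of `c₋`.
[cite: Balaban1985Variational, (8) p.279; Balaban1987RG1, (0.11) p.253] -/
def obLift (A : PBond (F.P K) k → ℝ) : PBond (F.P K) 0 → ℝ :=
  fun b => ∑ c : PBond (F.P K) k, A c * obKernel F K k c.src c.dir b

variable {F K k}

/-- `obLift` is additive. [folklore] -/
theorem obLift_add (A B : PBond (F.P K) k → ℝ) : obLift F K k (A + B) = obLift F K k A + obLift F K k B := by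
  funext b
  simp only [obLift, Pi.add_apply, add_mul, Finset.sum_add_distrib]

/-- `obLift` is homogeneous. [folklore] -/
theorem obLift_smul (r : ℝ) (A : PBond (F.P K) k → ℝ) : obLift F K k (r • A) = r • obLift F K k A := by
  funext b
  simp only [obLift, Pi.smul_apply, smul_eq_mul, mul_assoc, Finset.mul_sum]

variable (F K k) in
/-- **THE ONE-BLOCK LIFT AS A LINEAR MAP** (for the `byEntry` ∕ CLM packaging of the matrix port). [folklore] -/
def obLiftL : (PBond (F.P K) k → ℝ) →ₗ[ℝ] (PBond (F.P K) 0 → ℝ) where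
  toFun := obLift F K k
  map_add' := obLift_add
  map_smul' := obLift_smul

/-- `obLiftL` is `obLift`. [folklore] -/
@[simp] theorem obLiftL_apply (A : PBond (F.P K) k → ℝ) : obLiftL F K k A = obLift F K k A := rfl

end Defs

end Summit.QuantumFields.YangMills.Theorems.AbelianEML.OneBlock

end
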